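import Summits.HubbardSuperconductivity.HubbardSuperconductivity.Theorems.AnisotropyChordTransferFibre3FinXDCheck

/-!
# Route `AnisotropyChord` / H0 rotor rung: FIN per-`L` row-D (KT-2a″) SUB-CELL facts, `L = 9` (120–125)

Row-D facts `xdCellAny0 9 (49/50) la lb aD = true` on quarter sub-cells of the combined cells whose side condition needs `aD ≈ .04` (mechhunt STATUS p3 g7 REPORT 3).
Prover seat `hubbard-h0-rotor-p3` g7; helper for piece A = stmt-HubbardSuperconductivity-23918 of rung 19089 (`--supports`, helper class).
WHAT THIS IS NOT: nothing here proves superconductivity in the Hubbard model (rotor TARGET as worded stays FALSE, g15 verdict); kernel facts /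
assembly for ONE conditional reduction at one `L`.  No sorry.
-/

set_option linter.dupNamespace false
set_option autoImplicit false

namespace Summit.HubbardSuperconductivity.HubbardSuperconductivity.Theorems.AnisotropyChord.Transfer.Fibre3

namespace FinXD

/-- row-D sub-cell `[22561097587460233, 22702104447381859]` of `L = 9`. [folklore] -/
theorem xd9s_141_0 : xdCellAny0 9 (49/50 : ℚ) 22561097587460233 22702104447381859 (1/25 : ℚ) = true := by decide +kernel

/-- row-D sub-cell `[22702104447381859, 22843111307303485]` of `L = 9`. [folklore] -/
theorem xd9s_141_1 : xdCellAny0 9 (49/50 : ℚ) 22702104447381859 22843111307303485 (1/25 : ℚ) = true := by decide +kernel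

/-- row-D sub-cell `[22843111307303485, 22984118167225111]` of `L = 9`. [folklore] -/
theorem xd9s_141_2 : xdCellAny0 9 (49/50 : ℚ) 22843111307303485 22984118167225111 (1/25 : ℚ) = true := by decide +kernel

/-- row-D sub-cell `[22984118167225111, 23125125027146737]` of `L = 9`. [folklore] -/
theorem xd9s_141_3 : xdCellAny0 9 (49/50 : ℚ) 22984118167225111 23125125027146737 (1/25 : ℚ) = true := by decide +kernel

/-- row-D sub-cell `[23125125027146737, 23269657058566404]` of `L = 9`. [folklore] -/
theorem xd9s_142_0 : xdCellAny0 9 (49/50 : ℚ) 23125125027146737 23269657058566404 (1/25 : ℚ) = true := by decide +kernel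

/-- row-D sub-cell `[23269657058566404, 23414189089986071]` of `L = 9`. [folklore] -/
theorem xd9s_142_1 : xdCellAny0 9 (49/50 : ℚ) 23269657058566404 23414189089986071 (1/25 : ℚ) = true := by decide +kernel

end FinXD

end Summit.HubbardSuperconductivity.HubbardSuperconductivity.Theorems.AnisotropyChord.Transfer.Fibre3
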